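import Summits.AtomisticToContinuum.HydrodynamicLimit.Theses.TwoClocks
import Summits.AtomisticToContinuum.HydrodynamicLimit.Theses.OneFlightGossipEngine
import Summits.AtomisticToContinuum.HydrodynamicLimit.Theorems.ImplosionDichotomyHydroLimitInBandOfHeart
import Summits.AtomisticToContinuum.HydrodynamicLimit.Theorems.ImplosionDichotomyHydroLimitInBandActivityTailsOfTransfer
import Summits.AtomisticToContinuum.HydrodynamicLimit.Theorems.TwoClocksTransferEntropyClockFamilyNodesReduction
import Summits.AtomisticToContinuum.HydrodynamicLimit.Theorems.TwoClocksTransferEntropyClockWindowUpgrade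
import Summits.AtomisticToContinuum.HydrodynamicLimit.Theorems.TwoClocksTransferEntropyClockEquilibriumFamily
import Summits.AtomisticToContinuum.HydrodynamicLimit.Theorems.OneFlightGossipEngineClampedTransferDockWindowClauseRate
import Summits.AtomisticToContinuum.HydrodynamicLimit.Theorems.OneFlightGossipEngineClampedTransferDockLedgerEndD
import Summits.AtomisticToContinuum.HydrodynamicLimit.Theorems.ImplosionDichotomyHydroLimitInBandWindowContinuity
import Summits.AtomisticToContinuum.HydrodynamicLimit.Theorems.OneFlightGossipEngineAssembly
import HarnessLib

/-!
# Skeleton v10 — line `Sketch`, crux stmt-AtomisticToContinuum-16625 `TwoClocks.TransferEntropyClock`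
# (lead prover-line-stmt-AtomisticToContinuum-16625-c5-0, 2026-08-17; v10 = v9 with the TRUE-LAW coherence stub S5′
# `stub_oddWindowLLN : BoundedOddWindowLLN` RESHAPED into the two REFERENCE-LAW / tail children of the sibling crux 17615 —
# S6 `stub_seet : SuperExponentialEnergyTails` and S7 `stub_bandCoherenceLD : BandCoherenceLDFamily` — and the composition re-docked
# from the 9133 heart into 17615's LANDED conditional closing `ClampedTransferDockSketch.clampedTransferDock_of_inputs_transfer`;
# 4 sorries = the 4 OPEN stubs S3b, S4, S6, S7, every one shared verbatim with a sibling crux (16659 / 17615))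

WHY v10. The v9 coherence child (the heart's `CoherentSuprathermalContentVanishesW`, or its reshaped form `BoundedOddWindowLLN`) centres
the peculiar velocity at the EULER field `u_s` under the TRUE law at time `s`; given tagged-particle mixing it forces the true local mean
velocity at time `s` to be `u_s` — the momentum part of the hydrodynamic limit at time `s`, which the clock itself produces from the running
entropy but which the 9133 heart demands as an unconditional input (see `Lines/Sketch.md` c5 §6, PROMOTE-STUBS-c5.md). Crux 17615 re-threads
the suprathermal cubic channel through the REFERENCE law (`BandCoherenceLDFamily`, a small-tilt exponential moment paid inside the Grönwall by
the running entropy) plus the true-law super-exponential energy tails SEET (Nachtergaele–Yau Assumption II.1 type; `HighMomentumCutoff → SEET`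
landed), and its conditional closing is landed. v10 adopts that typing: the 16625 clock and the 17615 dock now split into ONE child set.

`TransferEntropyClock := KineticWindowLDUniform → ClampedTransferWindowLD → TransferActivityTails → EnergyCurrentTails →
DiluteSelfConsistency → _root_.HydrodynamicLimit`. Composition (kernel-checked, `TransferEntropyClock_of` below), over LANDED modules only:
* 17615's closing `ClampedTransferDockSketch.clampedTransferDock_of_inputs : SEET → BandCoherenceLDFamily → LocalClampedTransferWindowLDFamily →
  CollisionEnergyActivityTails → OneFlightGossipEngine.ClampedTransferDock` (p140743), where
  `ClampedTransferDock := KineticCurrentsLDAlongFamilies → CollisionActivityTails → EnergyCurrentTails → _root_.HydrodynamicLimit` — INLINED below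
  (`clampedTransferDock_of_inputs'`, its six-line proof verbatim over the four landed + built plumbing theorems p136014 / p138311 / p139114 / p139514,
  the landed window continuity and ledger end) only until the farm has built p140743's module, then imported;
* the kinetic upgrade, provable half: `TransferEntropyClockWindows.stub_windowUpgrade` (S3x, p135645) and
  `TransferEntropyClockFrame.stub_equilibriumFamily` (S3a, p136147); the heart's `KineticCurrentsWindowLDFamily` is the dock's binder
  `KineticCurrentsLDAlongFamilies` (same term);
* identifications (landed, `Iff.rfl`): `TransferEntropyClockFamilyNodes.transferActivityTails_iff_dock`, `twoClocks_energyCurrentTails_iff`;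
  CAT from TA by `HydroLimitInBandHeart.activityTails_of_transferActivityTails`.
The variant-A composition (v9: dock into the 9133 heart with `BoundedOddWindowLLN`) stays recorded in `Theorems/TwoClocksTransferEntropyClockRestatedOdd.lean` (p140895).

Open stubs (all crux-sized; each shared verbatim with a sibling crux):
* S3b `stub_kineticFamilyOfEquilibrium : KineticFamilyOfEquilibrium` — `EquilibriumKineticLDFamily → KineticCurrentsWindowLDFamily`
  (target = stmt-16659's decl, reduced by its lead to `stub_kcwuSharpPlus`, p137412);
* S4 `stub_localTransferFamily : LocalTransferFamilyUpgrade` — `ClampedTransferWindowLD → TransferActivityTails → LocalClampedTransferWindowLDFamily`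
  (target = 17615's `stub_localClampedTransferLD`, child (iii) of the 9133 split; implies C′ stmt-16623);
* S6 `stub_seet : SuperExponentialEnergyTails` (= 17615's `stub_seet`; partial results `OneFlightGossipEngineClampedTransferDockSeet.lean`);
* S7 `stub_bandCoherenceLD : BandCoherenceLDFamily` (= 17615's `stub_bandCoherenceLD`).
-/

namespace Summit.AtomisticToContinuum.HydrodynamicLimit.Theorems.TransferEntropyClockLine

open Summit.AtomisticToContinuum.HydrodynamicLimit.Theses
open Summit.AtomisticToContinuum.HydrodynamicLimit.Theorems
open Summit.AtomisticToContinuum.HydrodynamicLimit.Theorems.HydroLimitInBandOfHeart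
  (GronwallCoreInBand LocalClampedTransferWindowLDFamily CollisionEnergyActivityTails KineticCurrentsWindowLDFamily)
open Summit.AtomisticToContinuum.HydrodynamicLimit.Theorems.ClampedCurrentsDockFromWindows (WindowContinuityInBand)
open Summit.AtomisticToContinuum.HydrodynamicLimit.Theorems.TransferEntropyClockFrame
  (EquilibriumKineticLDFamily stub_equilibriumFamily)
open Summit.AtomisticToContinuum.HydrodynamicLimit.Theorems.ClampedTransferDockCubicRate
  (SuperExponentialEnergyTails BandCoherenceLDFamily stub_cubicChannelRate)
open Summit.AtomisticToContinuum.HydrodynamicLimit.Theorems.ClampedTransferDockRate (stub_windowEstimateRate stub_windowClauseRate)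
open Summit.AtomisticToContinuum.HydrodynamicLimit.Theorems.ClampedTransferDockLedgerEndD (stub_ledgerEndD)
open Summit.AtomisticToContinuum.HydrodynamicLimit.Theorems.TransferEntropyClockFamilyNodes
  (transferActivityTails_iff_dock)
open MeasureTheory
open Literature.MathematicalPhysics.KineticTheory Literature.Analysis.FluidPDE Literature.Analysis.FunctionSpaces

/-! ## §1 Stub signatures (open, crux-sized) -/

/-- S3b: locality + density direction of the kinetic node — from the equilibrium family node (constant profiles at one σ, LANDED
consequence of the pointwise node: `TransferEntropyClockFrame.EquilibriumKineticLDFamily`) to the heart's local family node (local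
Gibbs data, x-dependent profiles, activity-ratio guard). -/
def KineticFamilyOfEquilibrium : Prop :=
  EquilibriumKineticLDFamily → KineticCurrentsWindowLDFamily

/-- S4: localisation + family-uniformity of the global-equilibrium transfer-clamped collisional window LD, priced by the
transfer-activity tails (C′ is exactly the constant-family instance; TA idle). -/
def LocalTransferFamilyUpgrade : Prop :=
  TwoClocks.ClampedTransferWindowLD → TwoClocks.TransferActivityTails → LocalClampedTransferWindowLDFamily

/-! ## §2 Stubs -/

/-- S3b (open, crux-sized). -/
theorem stub_kineticFamilyOfEquilibrium : KineticFamilyOfEquilibrium := by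
  sorry

/-- S4 (open, crux-sized). -/
theorem stub_localTransferFamily : LocalTransferFamilyUpgrade := by
  sorry

/-- S6 (open, crux-sized; verbatim 17615's `stub_seet`): super-exponential energy tails under the true pre-shock law at fixed
times (Nachtergaele–Yau Assumption II.1 type). -/
theorem stub_seet : SuperExponentialEnergyTails := by
  sorry

/-- S7 (open, crux-sized; verbatim 17615's `stub_bandCoherenceLD`): the reference-law band exponential moment at tilt
`(8 Θ̄ K₁)⁻¹` for the guarded suprathermal coherence functional along local Gibbs families. -/
theorem stub_bandCoherenceLD : BandCoherenceLDFamily := by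
  sorry

/-! ## §3 Composition over landed theorems -/

/-- The heart's kinetic family node from the pointwise docking node: S3x (landed) → S3a (landed) → S3b (stub). -/
theorem kineticFamily_of_pointwise (hKW : TwoClocks.KineticWindowLDUniform) : KineticCurrentsWindowLDFamily :=
  stub_kineticFamilyOfEquilibrium
    (stub_equilibriumFamily
      (show TransferEntropyClockFrame.WindowUpgrade from TransferEntropyClockWindows.stub_windowUpgrade) hKW)

/-- 17615's landed conditional closing `ClampedTransferDockSketch.clampedTransferDock_of_inputs` (p140743), proof verbatim over its
landed and built ingredients (inlined only until the farm has built that module; then `import …ClampedTransferDockOfInputs`). -/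
theorem clampedTransferDock_of_inputs' : SuperExponentialEnergyTails → BandCoherenceLDFamily →
    LocalClampedTransferWindowLDFamily → CollisionEnergyActivityTails → OneFlightGossipEngine.ClampedTransferDock := by
  intro hS hB h₃ h₄ hK h₇ h₆
  have hKF : KineticCurrentsWindowLDFamily := hK
  have hOW := stub_windowClauseRate stub_windowEstimateRate stub_cubicChannelRate hB hS h₃ h₄ hKF h₇ h₆
  have hC : WindowContinuityInBand := HydroLimitInBandContinuity.stub_windowContinuityInBand h₇ h₄ h₆
  have hG : GronwallCoreInBand := stub_ledgerEndD hOW hC EntropyClockDock.ledgerAprioriBound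
  exact Theorems.hydroLimitInBand_of_relEntropyVanishingInBand
    (EntropyClockDock.relEntropyVanishingInBand_of_gronwallCoreInBand hG)

/-- **The crux by name**: 17615's conditional closing fed the four nodes, the dock's three binders discharged by the kinetic
family node (same term), CAT / CEAT from the transfer-activity tails, and ECT by name. -/
theorem TransferEntropyClock_of : TwoClocks.TransferEntropyClock :=
  fun hKW h₃ h₇ h₆ _ =>
    have hT := HydroLimitInBandHeart.activityTails_of_transferActivityTails (transferActivityTails_iff_dock.mp h₇)
    clampedTransferDock_of_inputs' stub_seet stub_bandCoherenceLD (stub_localTransferFamily h₃ h₇) hT.2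
      (show OneFlightGossipEngine.KineticCurrentsLDAlongFamilies from kineticFamily_of_pointwise hKW)
      hT.1 (twoClocks_energyCurrentTails_iff.mp h₆)

end Summit.AtomisticToContinuum.HydrodynamicLimit.Theorems.TransferEntropyClockLine
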